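import Literature.AlgebraicGeometry.Motives.AbelianVarietyIsogenyCovering
import Literature.AlgebraicGeometry.HodgeTheory.HodgeClassesIsogenyInvariance
import HarnessLib

/-!
# The quotient `A/S` of a complex abelian variety by a finite subgroup `S ⊆ A[n](ℂ)` as a CARRIER:
# the isogeny `A → A/S` with prescribed kernel and its isomorphisms on `H^*(–(ℂ); ℂ)`

Layer `Literature/AlgebraicGeometry/Motives`, namespace `Literature.AlgebraicGeometry.Motives.AbelianVariety`.
Typer seat `hodge-lit-avcarriers` (cell `pub-hodge-ring2`, ask `LEAD/ASK#carriers-secant-anchor` item (c):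
"the quotient of an abelian variety by a finite subgroup (isogeny with prescribed kernel) as a carrier + the
induced maps on `complexBetti`").

Everything scheme-theoretic is ALREADY in the tree and is only PACKAGED here:
`AbelianVariety.quot L S hS q hSq hq` (`Motives/AbelianVarietyQuotientGroup`: the quotient abelian variety
`P/S` of `P` by a finite Galois-stable subgroup `S ⊆ P(L)` killed by an auxiliary finite endomorphism `q`,
Mumford §7 Thm. 4), its quotient isogeny `quotHom`, and the `ℂ`-form lemmas of
`Motives/AbelianVarietyIsogenyCovering` (`smul_mem_of_algEquiv_self`, `comp_zsmul_id_eq_one_of_le_torsionPoints`,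
`isFinite_toSchemeHom_zsmul_id`, `finite_of_le_torsionPoints`, `ker_monoidHom_quotHom`,
`surjective_monoidHom_quotHom`, `exists_quotHom_comp_eq_zsmul_id`), where the auxiliary endomorphism is
`q = [n]_A` for a subgroup `S ⊆ A[n](ℂ)`. The six-argument term is abbreviated to the three-argument carrier

* `A.torsionQuot hn S hS : AbelianVariety ℂ` — **`A/S` for `S ≤ A[n](ℂ)`, `n ≠ 0`**, with
  `A.torsionQuotHom hn S hS : A ⟶ A.torsionQuot hn S hS` — **the quotient isogeny `π : A → A/S`**;

and the printed properties are restated on it (all PROVED, by the cited tree theorems):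

* `isIsogeny_torsionQuotHom`, `dim_torsionQuot` (`dim A/S = dim A`);
* `ker_monoidHom_torsionQuotHom` / `mem_kerPoints_torsionQuotHom_iff` — **`Ker π (ℂ) = S`** (Mumford §7 Thm. 4:
  "`X → X/S` is an isogeny with kernel `S`"; Milne, *Abelian Varieties* I Rem. 8.12: "`π : A → B = A/G` is an
  isogeny with kernel `G`");
* `surjective_monoidHom_torsionQuotHom` and `pointsQuotientEquiv : A(ℂ)/S ≃* (A/S)(ℂ)` — on complex points
  `A/S` IS the quotient group;
* `exists_torsionQuotHom_comp_eq_zsmul_id` (`[n]_A` factors through `π`) and the universal property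
  `exists_torsionQuotHom_comp_eq` (a homomorphism `h : A → C` killing `Ker π` scheme-theoretically factors
  through `π`; Milne I Rem. 8.12 "using the universal property of quotients … there is a (unique) regular map
  `β : B → C` such that `β ∘ α = γ`"; the tree's `IsIsogeny.exists_comp_eq_of_kerPoints_le_holds`);
* **on the real carrier `complexBetti`**: `complexBetti_map_torsionQuotHom_bijective` — `π^* : Hᵏ((A/S)(ℂ); ℂ)
  → Hᵏ(A(ℂ); ℂ)` is bijective in every degree (van Geemen 1994 §3.6; the tree's
  `complexBetti_map_bijective_of_isIsogeny`) — and `bijOn_hodgeClasses_torsionQuotHom` — `π^*` is a bijection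
  of the rational `(p,p)`-classes (`bijOn_hodgeClasses_of_isIsogeny`). So a class `θ_Y` on `Y = A/S` is the
  same datum as the class `π^*θ_Y` on `A`, and conversely every class on `A` DESCENDS uniquely along `π^*`
  (`existsUnique_complexBetti_map_torsionQuotHom_eq`).

No new named fact, no instance, no notation (typer lint); D-0026 net debt 0. Nothing here is specific to
`ℂ` mathematically (Mumford §7 Thm. 4 holds over any field for finite subgroup schemes), but the tree's
`ℂ`-form lemmas are over `ℂ/ℂ` and the consumers (Hodge cells) live there — `TODO(general form)`: the same
package over a field `K` with `S ⊆ A(L)` Galois-stable, which is literally `AbelianVariety.quot`.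

## References

* [MumfordAV1970] D. Mumford, *Abelian Varieties* (1970), §7 Thm. 4 (p. 72): quotient by a finite subgroup,
  an isogeny with kernel the subgroup.
* [MilneAV2008] J. S. Milne, *Abelian Varieties* (course notes v2.00, 2008), I §7 "Isogenies" (p. 32) and I §8,
  Rem. 8.6, Prop. 8.10, Rem. 8.12 (pp. 36–39): `B = A/G` is an abelian variety, `π` an isogeny with kernel `G`,
  universal property, `α = β ∘ n_A` when `Ker α ⊇ A_n`.
* [vanGeemen1994HodgeAV] B. van Geemen, LNM 1594 (1994), §3.6 (p. 236): an isogeny induces `φ^* : Hᵏ(X, ℚ) ≅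
  Hᵏ(Y, ℚ)` and bijections `Bᵖ(X) → Bᵖ(Y)`.
-/

noncomputable section

universe u

open CategoryTheory AlgebraicGeometry

namespace Literature.AlgebraicGeometry.Motives

namespace AbelianVariety

open scoped MonObj
open Literature.AlgebraicGeometry.HodgeTheory

variable (A : AbelianVariety ℂ)

/-! ### The carrier `A/S` and its quotient isogeny -/

/-- `[n]_A` is an affine morphism for `n ≠ 0` (it is finite: `isFinite_toSchemeHom_zsmul_id`). The instance
argument of `AbelianVariety.quot`. [cite: MumfordAV1970, §7 Thm. 4 p. 72] -/
theorem isAffineHom_toSchemeHom_zsmul_id {n : ℕ} (hn : n ≠ 0) : IsAffineHom (Hom.toSchemeHom ((n : ℤ) • 𝟙 A)) :=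
  haveI := A.isFinite_toSchemeHom_zsmul_id hn
  inferInstance

variable {n : ℕ} (hn : n ≠ 0) (S : Subgroup (A.Points ℂ)) (hS : S ≤ A.torsionPoints ℂ n)

/-- **The quotient abelian variety `A/S`** of a complex abelian variety `A` by a subgroup `S ⊆ A[n](ℂ)` of its
`n`-torsion points (`n ≠ 0`; every finite subgroup of `A(ℂ)` lies in some `A[n](ℂ)`): the tree's
`AbelianVariety.quot` over `ℂ/ℂ` with auxiliary isogeny `[n]_A` (Mumford, *Abelian Varieties* §7 Thm. 4:
"`X/S` is an abelian variety and `X → X/S` an isogeny with kernel `S`"; Milne I Rem. 8.12).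
[cite: MumfordAV1970, §7 Thm. 4 p. 72] [cite: MilneAV2008, I §8 Rem. 8.12 (p. 39)] -/
def torsionQuot : AbelianVariety ℂ :=
  haveI := A.isAffineHom_toSchemeHom_zsmul_id hn
  haveI : Finite S := A.finite_of_le_torsionPoints hn hS
  A.quot ℂ S (A.smul_mem_of_algEquiv_self S) ((n : ℤ) • 𝟙 A)
    (A.comp_zsmul_id_eq_one_of_le_torsionPoints hS) (A.isFinite_toSchemeHom_zsmul_id hn)

/-- **The quotient isogeny `π : A → A/S`** (the tree's `quotHom`). [cite: MumfordAV1970, §7 Thm. 4 p. 72] -/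
def torsionQuotHom : A ⟶ A.torsionQuot hn S hS :=
  haveI := A.isAffineHom_toSchemeHom_zsmul_id hn
  haveI : Finite S := A.finite_of_le_torsionPoints hn hS
  A.quotHom ℂ S (A.smul_mem_of_algEquiv_self S) ((n : ℤ) • 𝟙 A)
    (A.comp_zsmul_id_eq_one_of_le_torsionPoints hS) (A.isFinite_toSchemeHom_zsmul_id hn)

/-- `π : A → A/S` is an isogeny (surjective and finite). [cite: MumfordAV1970, §7 Thm. 4 p. 72] -/
theorem isIsogeny_torsionQuotHom : IsIsogeny (A.torsionQuotHom hn S hS) := by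
  haveI := A.isAffineHom_toSchemeHom_zsmul_id hn
  haveI : Finite S := A.finite_of_le_torsionPoints hn hS
  exact A.isIsogeny_quotHom ℂ S _ _ _ _

/-- `dim A/S = dim A` (isogenous abelian varieties have the same dimension). [cite: MumfordAV1970, §7 Application 3 (p. 63)] -/
theorem dim_torsionQuot : (A.torsionQuot hn S hS).dim = A.dim :=
  (dim_eq_of_isIsogeny (A.isIsogeny_torsionQuotHom hn S hS)).symm

/-! ### The kernel and the points of `A/S` -/

/-- **`Ker π (ℂ) = S`**: the kernel of `π(ℂ) : A(ℂ) → (A/S)(ℂ)` is `S` (Mumford §7 Thm. 4; Milne I Rem. 8.12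
"`π : A → B` is an isogeny with kernel `G`"). [cite: MumfordAV1970, §7 Thm. 4 p. 72] [cite: MilneAV2008, I §8 Rem. 8.12 (p. 39)] -/
theorem ker_monoidHom_torsionQuotHom :
    (IsMonHom.monoidHom (A.torsionQuotHom hn S hS).hom.hom.hom (specOver ℂ ℂ)).ker = S := by
  haveI := A.isAffineHom_toSchemeHom_zsmul_id hn
  haveI : Finite S := A.finite_of_le_torsionPoints hn hS
  exact A.ker_monoidHom_quotHom hn S hS

/-- `Ker π (ℂ) = S` in the `kerPoints` spelling: a complex point `x` of `A` dies under `π` iff `x ∈ S`.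
[cite: MumfordAV1970, §7 Thm. 4 p. 72] -/
theorem mem_kerPoints_torsionQuotHom_iff (x : A.Points ℂ) :
    x ∈ Hom.kerPoints (specOver ℂ ℂ) (A.torsionQuotHom hn S hS) ↔ x ∈ S := by
  have h := A.ker_monoidHom_torsionQuotHom hn S hS
  exact ⟨fun hx ↦ h ▸ (hx : x ∈ (IsMonHom.monoidHom _ (specOver ℂ ℂ)).ker),
    fun hx ↦ ((h.symm ▸ hx : x ∈ (IsMonHom.monoidHom _ (specOver ℂ ℂ)).ker) : _)⟩

/-- `Ker π (ℂ) = S` as an equality of subgroups of `A(ℂ)` (`kerPoints` spelling). [cite: MumfordAV1970, §7 Thm. 4 p. 72] -/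
theorem kerPoints_torsionQuotHom_eq : Hom.kerPoints (specOver ℂ ℂ) (A.torsionQuotHom hn S hS) = S :=
  Subgroup.ext (A.mem_kerPoints_torsionQuotHom_iff hn S hS)

/-- Every `s ∈ S` dies under `π`: `s ≫ π = 1`. [cite: MumfordAV1970, §7 Thm. 4 p. 72] -/
theorem comp_torsionQuotHom_eq_one {s : A.Points ℂ} (hs : s ∈ S) :
    s ≫ (A.torsionQuotHom hn S hS).hom.hom.hom = 1 :=
  (Hom.mem_kerPoints_iff _ _).1 ((A.mem_kerPoints_torsionQuotHom_iff hn S hS s).2 hs)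

/-- **`π(ℂ) : A(ℂ) → (A/S)(ℂ)` is surjective.** [cite: MumfordAV1970, §7 Thm. 4 p. 72] -/
theorem surjective_monoidHom_torsionQuotHom :
    Function.Surjective (IsMonHom.monoidHom (A.torsionQuotHom hn S hS).hom.hom.hom (specOver ℂ ℂ)) := by
  haveI := A.isAffineHom_toSchemeHom_zsmul_id hn
  haveI : Finite S := A.finite_of_le_torsionPoints hn hS
  exact A.surjective_monoidHom_quotHom hn S hS

/-- **On complex points `A/S` is the quotient group: `A(ℂ)/S ≃* (A/S)(ℂ)`**, induced by `π(ℂ)` (first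
isomorphism theorem with `Ker π(ℂ) = S` and surjectivity; Mumford §7 Thm. 4 (1): "as a topological space /
set, `X/S` is the quotient"). [cite: MumfordAV1970, §7 Thm. 4 p. 72] [cite: MilneAV2008, I §8 Prop. 8.10 (a) (p. 38)] -/
def pointsQuotientEquiv : A.Points ℂ ⧸ S ≃* (A.torsionQuot hn S hS).Points ℂ :=
  (QuotientGroup.quotientMulEquivOfEq (A.ker_monoidHom_torsionQuotHom hn S hS)).symm.trans
    (QuotientGroup.quotientKerEquivOfSurjective _ (A.surjective_monoidHom_torsionQuotHom hn S hS))

/-- `pointsQuotientEquiv` is induced by `π(ℂ)`: the class of `x` goes to `π(x)`. [cite: MumfordAV1970, §7 Thm. 4 p. 72] -/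
theorem pointsQuotientEquiv_mk (x : A.Points ℂ) :
    A.pointsQuotientEquiv hn S hS (QuotientGroup.mk x) =
      IsMonHom.monoidHom (A.torsionQuotHom hn S hS).hom.hom.hom (specOver ℂ ℂ) x :=
  rfl

/-! ### The universal property -/

/-- **`[n]_A` factors through `π`**: there is `r : A/S → A` with `π ≫ r = [n]_A` (Milne I Rem. 8.6 / 8.12:
"if `Ker α ⊇ A_n` then `α = β ∘ n_A`", here for `α = [n]`, `S ⊆ A[n]`). [cite: MilneAV2008, I §8 Rem. 8.6 and Rem. 8.12 (pp. 36–39)] -/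
theorem exists_torsionQuotHom_comp_eq_zsmul_id :
    ∃ r : A.torsionQuot hn S hS ⟶ A, A.torsionQuotHom hn S hS ≫ r = (n : ℤ) • 𝟙 A := by
  haveI := A.isAffineHom_toSchemeHom_zsmul_id hn
  haveI : Finite S := A.finite_of_le_torsionPoints hn hS
  exact A.exists_quotHom_comp_eq_zsmul_id hn S hS

/-- **Universal property of `A → A/S`**: a homomorphism `h : A → C` whose scheme-theoretic kernel contains
`Ker π` (on `T`-valued points for every `ℂ`-scheme `T`) factors through `π` (Milne I Rem. 8.12: "using the
universal property of quotients … there is a (unique) regular map `β : B → C` such that `β ∘ α = γ`; moreover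
`β` is automatically a homomorphism"; the tree's fpqc-descent theorem
`IsIsogeny.exists_comp_eq_of_kerPoints_le_holds`). [cite: MilneAV2008, I §8 Rem. 8.12 (p. 39)] [cite: GortzWedhorn2023, §(27.33) p. 882 (1)] -/
theorem exists_torsionQuotHom_comp_eq {C : AbelianVariety ℂ} (h : A ⟶ C)
    (hle : ∀ T : SchemeOver ℂ, Hom.kerPoints T (A.torsionQuotHom hn S hS) ≤ Hom.kerPoints T h) :
    ∃ g : A.torsionQuot hn S hS ⟶ C, A.torsionQuotHom hn S hS ≫ g = h :=
  IsIsogeny.exists_comp_eq_of_kerPoints_le_holds (A.isIsogeny_torsionQuotHom hn S hS) h hle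

/-- The factorisation through `π` is unique (`π` is an isogeny, hence an epimorphism among homomorphisms).
[cite: GortzWedhorn2023, Prop. 27.178 (1)] -/
theorem torsionQuotHom_comp_cancel {C : AbelianVariety ℂ} {g g' : A.torsionQuot hn S hS ⟶ C}
    (h : A.torsionQuotHom hn S hS ≫ g = A.torsionQuotHom hn S hS ≫ g') : g = g' :=
  (A.isIsogeny_torsionQuotHom hn S hS).cancel_left h

/-! ### The induced maps on `complexBetti` -/

/-- **`π^* : Hᵏ((A/S)(ℂ); ℂ) → Hᵏ(A(ℂ); ℂ)` is bijective in every degree** (an isogeny induces isomorphisms on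
rational — here complex — cohomology; van Geemen §3.6; the tree's `complexBetti_map_bijective_of_isIsogeny`).
[cite: vanGeemen1994HodgeAV, §3.6 (p. 236)] -/
theorem complexBetti_map_torsionQuotHom_bijective (k : ℕ) :
    Function.Bijective (complexBetti.map (A.torsionQuotHom hn S hS).hom.hom.hom k) :=
  complexBetti_map_bijective_of_isIsogeny (A.isIsogeny_torsionQuotHom hn S hS) k

/-- **Descent of classes along `π^*`**: every class `c ∈ Hᵏ(A(ℂ); ℂ)` is `π^* d` for a unique class `d` on
`A/S` (surjectivity and injectivity of `π^*`). [cite: vanGeemen1994HodgeAV, §3.6 (p. 236)] -/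
theorem existsUnique_complexBetti_map_torsionQuotHom_eq (k : ℕ) (c : complexBetti A.X k) :
    ∃! d : complexBetti (A.torsionQuot hn S hS).X k,
      complexBetti.map (A.torsionQuotHom hn S hS).hom.hom.hom k d = c :=
  (A.complexBetti_map_torsionQuotHom_bijective hn S hS k).existsUnique c

/-- **`π^*` is a bijection of the rational `(p,p)`-classes** of `A/S` onto those of `A` (van Geemen §3.6 "an
isogeny `φ` induces isomorphisms `Bᵖ(X) → Bᵖ(Y)`"; the tree's `bijOn_hodgeClasses_of_isIsogeny`).
[cite: vanGeemen1994HodgeAV, §3.6 (p. 236)] -/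
theorem bijOn_hodgeClasses_torsionQuotHom (p : ℕ) :
    Set.BijOn (complexBetti.map (A.torsionQuotHom hn S hS).hom.hom.hom (2 * p))
      {c : complexBetti (A.torsionQuot hn S hS).X (2 * p) |
        IsRationalClass c ∧ IsOfHodgeType (A.torsionQuot hn S hS).dim (A.torsionQuot hn S hS).X (2 * p) p p c}
      {c : complexBetti A.X (2 * p) | IsRationalClass c ∧ IsOfHodgeType A.dim A.X (2 * p) p p c} :=
  bijOn_hodgeClasses_of_isIsogeny (A.isIsogeny_torsionQuotHom hn S hS) p

/-- In particular a class `d` on `A/S` is rational of type `(p,p)` iff `π^* d` is (with `dim A/S = dim A`).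
[cite: vanGeemen1994HodgeAV, §3.6 (p. 236)] -/
theorem isRationalClass_and_isOfHodgeType_map_torsionQuotHom_iff (p : ℕ)
    (d : complexBetti (A.torsionQuot hn S hS).X (2 * p)) :
    (IsRationalClass (complexBetti.map (A.torsionQuotHom hn S hS).hom.hom.hom (2 * p) d) ∧
      IsOfHodgeType A.dim A.X (2 * p) p p (complexBetti.map (A.torsionQuotHom hn S hS).hom.hom.hom (2 * p) d)) ↔
    (IsRationalClass d ∧ IsOfHodgeType A.dim (A.torsionQuot hn S hS).X (2 * p) p p d) := by
  have hB := A.bijOn_hodgeClasses_torsionQuotHom hn S hS p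
  rw [A.dim_torsionQuot hn S hS] at hB
  constructor
  · intro h
    obtain ⟨d', hd', he⟩ := hB.surjOn h
    have : d' = d := (A.complexBetti_map_torsionQuotHom_bijective hn S hS (2 * p)).1 he
    exact this ▸ hd'
  · intro h
    exact hB.mapsTo h

end AbelianVariety

end Literature.AlgebraicGeometry.Motives

end
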